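import Literature.Probability.Process.BrownianVecModel
import Mathlib.MeasureTheory.Integral.IntegralEqImproper
import Mathlib.Probability.Independence.Integration
import HarnessLib

/-!
# Gaussian lemmas for Brownian bridges in `ℝ⁴`: density ratios, the lifetime integral, and "bridge part ⟂ endpoint"

Topic `Probability/Process`; proof-only file (small definitions with bodies, no named fact). These
are the Gaussian inputs of the `h`-transform density of the Brownian loop measure at `0` in `ℝ⁴`
(`BrownianLoopDensity4`), i.e. of the bridge construction of the Brownian bubble measure of
Lawler–Schramm–Werner, *Conformal restriction: the chordal case*, JAMS **16** (2003), §7.1,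
second bullet ("`μ = c Υ(T^{-1/2} n ⊗ P)`": a Brownian bridge glued to an independent Itô
excursion, mixed over the lifetime `T`), lifted to four dimensions as in the tree's treatment of
§4 (`RandomPlanarGeometry/BrownianExcursionRestriction`: the excursion is `W⁰ + i|w|` for a
four-dimensional Brownian motion `W = (W⁰, w)`, model `Process.brownianQuad`).

Contents (everything PROVED):

* `pi_withDensity_eq` — a finite product of probability measures with densities is the product
  measure with the product density;
* `gaussRatio`, `gaussianReal_eq_withDensity_gaussRatio`, `gaussVec_eq_withDensity_gaussRatio`,
  `gaussianPDFReal_div`, `prod_gaussRatio_eq` — `N(0, wI₄) = (∏ φ_w/φ_t) · N(0, tI₄)` and, for the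
  bridge variance `w = t(T−t)/T`, the closed form `(T/(T−t))² exp(−|z|²/(2(T−t)))` of the ratio;
* `integral_Ioi_exp_neg_div`, `lintegral_Ioi_weight_ratio` — the lifetime integral
  `∫_{T>t} e^{−b/(T−t)} dT/(2(T−t)²) = 1/(2b)`, whence `∫_{T>t} (dT/2T²)(T/(T−t))² e^{−b/(T−t)} = 1/(2b)`;
* `map_linComb_gaussVec_prod` — `c ξ + e η ~ N(0, (c²a + e²b)I_d)` for independent Gaussian vectors;
* `lintegral_comp_eq_lintegral_lintegral_of_indepFun` — Tonelli for independent random variables;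
* `IsPreBrownianReal.indepFun_bridge` (a dot-notation extension of Mathlib's structure, proved
  like Mathlib's `IsPreBrownianReal.indepFun_shift`: jointly Gaussian and uncorrelated), and its
  four-dimensional form `indepFun_quadBridgePast` for `brownianQuad`: **the bridge part
  `(W_s − (s/t)W_t)_{s ≤ t}` is independent of `W_t`**, with `vecPast_eq_quadBridgePast_add`:
  `W|[0,t] = bridge part + (·/t) W_t`.

## References

* G. F. Lawler, O. Schramm, W. Werner, *Conformal restriction: the chordal case*, J. Amer. Math.
  Soc. **16** (2003) 917–955, §7.1. [LawlerSchrammWerner2003Restriction]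
* G. F. Lawler, *Conformally Invariant Processes in the Plane*, AMS (2005), §5.2 (the Brownian
  bridge as `B_s − (s/t)B_t`). [Lawler2005]
* D. Revuz, M. Yor, *Continuous Martingales and Brownian Motion* (1999), Ch. I (Gaussian
  processes; independence from vanishing covariance). [RevuzYor1999]
-/

noncomputable section

open MeasureTheory ProbabilityTheory Filter Topology Set Finset
open scoped NNReal ENNReal BigOperators

namespace Literature.Probability.Process

/-! ### Products of probability measures with densities -/

/-- **A finite product of measures with densities is the product measure with the product
density** (probability factors): `⨂ᵢ (μᵢ · fᵢ) = (⨂ᵢ μᵢ) · ∏ᵢ fᵢ(xᵢ)`. [folklore] -/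
theorem pi_withDensity_eq {ι : Type*} [Fintype ι] {α : ι → Type*} [∀ i, MeasurableSpace (α i)]
    (μ : ∀ i, Measure (α i)) [∀ i, IsProbabilityMeasure (μ i)] {f : ∀ i, α i → ℝ≥0}
    (hf : ∀ i, Measurable (f i)) :
    Measure.pi (fun i ↦ (μ i).withDensity (fun x ↦ f i x)) =
      (Measure.pi μ).withDensity (fun x ↦ ∏ i, (f i (x i) : ℝ≥0∞)) := by
  classical
  refine Measure.pi_eq fun s hs ↦ ?_
  rw [withDensity_apply _ (MeasurableSet.univ_pi hs)]
  have h1 : ∫⁻ x in Set.univ.pi s, ∏ i, (f i (x i) : ℝ≥0∞) ∂Measure.pi μ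
      = ∫⁻ x, ∏ i, (s i).indicator (fun y ↦ (f i y : ℝ≥0∞)) (x i) ∂Measure.pi μ := by
    rw [← lintegral_indicator (MeasurableSet.univ_pi hs)]
    refine lintegral_congr fun x ↦ ?_
    by_cases hx : x ∈ Set.univ.pi s
    · rw [indicator_of_mem hx]
      refine Finset.prod_congr rfl fun i _ ↦ ?_
      rw [indicator_of_mem (hx i (Set.mem_univ _))]
    · rw [indicator_of_notMem hx]
      simp only [Set.mem_univ_pi, not_forall] at hx
      obtain ⟨i, hi⟩ := hx
      exact (Finset.prod_eq_zero (Finset.mem_univ i) (by rw [indicator_of_notMem hi])).symm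
  have h2 := lintegral_prod_eq_prod_lintegral_of_indepFun Finset.univ
    (fun i (x : ∀ i, α i) ↦ (s i).indicator (fun y ↦ (f i y : ℝ≥0∞)) (x i))
    (iIndepFun_pi (μ := μ) (X := fun i (y : α i) ↦ (s i).indicator (fun y ↦ (f i y : ℝ≥0∞)) y)
      (fun i ↦ ((hf i).coe_nnreal_ennreal.indicator (hs i)).aemeasurable))
    (fun i ↦ ((hf i).coe_nnreal_ennreal.indicator (hs i)).comp (measurable_pi_apply i))
  rw [h1, h2]
  refine Finset.prod_congr rfl fun i _ ↦ ?_
  rw [withDensity_apply _ (hs i), ← lintegral_indicator (hs i)]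
  exact (measurePreserving_eval μ i).lintegral_comp ((hf i).coe_nnreal_ennreal.indicator (hs i))

/-! ### Gaussian densities: `N(0, w)` against `N(0, v)` -/

/-- The ratio of two centred Gaussian densities, as an `ℝ≥0`-valued function. [folklore] -/
def gaussRatio (v w : ℝ≥0) (x : ℝ) : ℝ≥0 :=
  Real.toNNReal (gaussianPDFReal 0 w x / gaussianPDFReal 0 v x)

/-- The Gaussian density ratio is measurable. [folklore] -/
theorem measurable_gaussRatio (v w : ℝ≥0) : Measurable (gaussRatio v w) :=
  ((measurable_gaussianPDFReal 0 w).div (measurable_gaussianPDFReal 0 v)).real_toNNReal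

/-- **`N(0, w) = (φ_w/φ_v) · N(0, v)`** for nondegenerate variances. [folklore] -/
theorem gaussianReal_eq_withDensity_gaussRatio {v w : ℝ≥0} (hv : v ≠ 0) (hw : w ≠ 0) :
    gaussianReal 0 w = (gaussianReal 0 v).withDensity (fun x ↦ (gaussRatio v w x : ℝ≥0∞)) := by
  rw [gaussianReal_of_var_ne_zero _ hv, gaussianReal_of_var_ne_zero _ hw,
    ← withDensity_mul _ (measurable_gaussianPDF _ _) (measurable_gaussRatio v w).coe_nnreal_ennreal]
  congr 1
  funext x
  simp only [Pi.mul_apply, gaussianPDF, gaussRatio]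
  rw [ENNReal.ofReal, ENNReal.ofReal, ← ENNReal.coe_mul, ← Real.toNNReal_mul (gaussianPDFReal_nonneg _ _ _),
    mul_div_cancel₀ _ (gaussianPDFReal_pos _ _ _ hv).ne']

/-- **`N(0, w I_d) = (∏ᵢ φ_w(zᵢ)/φ_v(zᵢ)) · N(0, v I_d)`.** [folklore] -/
theorem gaussVec_eq_withDensity_gaussRatio (d : ℕ) {v w : ℝ≥0} (hv : v ≠ 0) (hw : w ≠ 0) :
    gaussVec d w = (gaussVec d v).withDensity (fun z ↦ ∏ i, (gaussRatio v w (z i) : ℝ≥0∞)) := by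
  unfold gaussVec
  rw [← pi_withDensity_eq (fun _ : Fin d ↦ gaussianReal 0 v) (fun _ ↦ measurable_gaussRatio v w)]
  congr 1
  funext i
  exact gaussianReal_eq_withDensity_gaussRatio hv hw

/-- The ratio of centred Gaussian densities in closed form:
`φ_w(x)/φ_v(x) = √(v/w) · exp(x²(1/v − 1/w)/2)`. [folklore] -/
theorem gaussianPDFReal_div {v w : ℝ≥0} (hv : v ≠ 0) (hw : w ≠ 0) (x : ℝ) :
    gaussianPDFReal 0 w x / gaussianPDFReal 0 v x =
      Real.sqrt ((v : ℝ) / w) * Real.exp (x ^ 2 * (1 / (v : ℝ) - 1 / w) / 2) := by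
  have hv' : (0 : ℝ) < v := by exact_mod_cast pos_iff_ne_zero.2 hv
  have hw' : (0 : ℝ) < w := by exact_mod_cast pos_iff_ne_zero.2 hw
  simp only [gaussianPDFReal_def, sub_zero]
  rw [show Real.sqrt ((v : ℝ) / w) = (Real.sqrt (2 * Real.pi * w))⁻¹ / (Real.sqrt (2 * Real.pi * v))⁻¹ by
    rw [inv_div_inv, ← Real.sqrt_div (by positivity)]
    congr 1
    field_simp]
  rw [mul_div_mul_comm, ← Real.exp_sub]
  congr 2
  field_simp
  ring

/-- **The bridge-variance density ratio on `ℝ⁴`**: for `0 < t < T` and `w = t(T−t)/T`,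
`∏ᵢ φ_w(zᵢ)/φ_t(zᵢ) = (T/(T−t))² exp(−|z|²/(2(T−t)))`. [folklore] -/
theorem prod_gaussRatio_eq {t w : ℝ≥0} {T : ℝ} (ht : 0 < t) (htT : (t : ℝ) < T)
    (hw : (w : ℝ) = t * (T - t) / T) (z : Fin 4 → ℝ) :
    (∏ i, (gaussRatio t w (z i) : ℝ≥0∞)) =
      ENNReal.ofReal ((T / (T - t)) ^ 2 * Real.exp (-(sqSum z) / (2 * (T - t)))) := by
  have ht' : (0 : ℝ) < t := by exact_mod_cast ht
  have hT : 0 < T := ht'.trans htT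
  have hTt : 0 < T - t := sub_pos.2 htT
  have hw0 : (0 : ℝ) < w := by rw [hw]; positivity
  have hwne : w ≠ 0 := by
    intro h; rw [h] at hw0; simp at hw0
  have hratio : ∀ x : ℝ, gaussianPDFReal 0 w x / gaussianPDFReal 0 t x =
      Real.sqrt (T / (T - t)) * Real.exp (-(x ^ 2) / (2 * (T - t))) := by
    intro x
    rw [gaussianPDFReal_div ht.ne' hwne, hw]
    congr 1
    · congr 1
      field_simp
    · congr 1
      field_simp
      ring
  rw [← ENNReal.ofNNReal_finsetProd]
  simp only [gaussRatio]
  rw [← Real.toNNReal_prod_of_nonneg (fun i _ ↦ div_nonneg (gaussianPDFReal_nonneg _ _ _)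
    (gaussianPDFReal_nonneg _ _ _))]
  simp only [hratio]
  rw [Finset.prod_mul_distrib, Finset.prod_const, Finset.card_univ, Fintype.card_fin, ← Real.exp_sum]
  change ((Real.toNNReal _ : ℝ≥0) : ℝ≥0∞) = ((Real.toNNReal _ : ℝ≥0) : ℝ≥0∞)
  congr 1
  congr 1
  congr 1
  · rw [show (4 : ℕ) = 2 * 2 from rfl, pow_mul, Real.sq_sqrt (by positivity)]
  · congr 1
    rw [sqSum, neg_div, Finset.sum_div, ← Finset.sum_neg_distrib]
    refine Finset.sum_congr rfl fun i _ ↦ ?_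
    ring

/-! ### The lifetime integral `∫_{T>t} e^{−b/(T−t)} dT/(2(T−t)²) = 1/(2b)` -/

/-- **`∫_{T>t} exp(−b/(T−t)) / (2(T−t)²) dT = 1/(2b)`** for `b > 0` (antiderivative
`exp(−b/(T−t))/(2b)`), together with the integrability of the integrand. [folklore] -/
theorem integral_Ioi_exp_neg_div {b : ℝ} (hb : 0 < b) (t : ℝ) :
    IntegrableOn (fun T ↦ Real.exp (-b / (T - t)) / (2 * (T - t) ^ 2)) (Ioi t) ∧
      ∫ T in Ioi t, Real.exp (-b / (T - t)) / (2 * (T - t) ^ 2) = 1 / (2 * b) := by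
  classical
  set G : ℝ → ℝ := fun T ↦ if T ≤ t then 0 else Real.exp (-b / (T - t)) / (2 * b) with hG
  have hderiv : ∀ T ∈ Ioi t, HasDerivAt G (Real.exp (-b / (T - t)) / (2 * (T - t) ^ 2)) T := by
    intro T hT
    have hTt : 0 < T - t := sub_pos.2 (mem_Ioi.1 hT)
    have hu : HasDerivAt (fun T : ℝ ↦ -b / (T - t)) (b / (T - t) ^ 2) T := by
      have h1 := ((hasDerivAt_inv hTt.ne').comp T ((hasDerivAt_id T).sub_const t)).const_mul (-b)
      have h2 : (fun T : ℝ ↦ -b / (T - t)) = fun y ↦ -b * ((Inv.inv ∘ fun y ↦ id y - t) y) := by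
        funext y; simp [div_eq_mul_inv]
      rw [h2]
      refine h1.congr_deriv ?_
      ring
    have h3 := (hu.exp).div_const (2 * b)
    have h4 : HasDerivAt (fun T ↦ Real.exp (-b / (T - t)) / (2 * b))
        (Real.exp (-b / (T - t)) / (2 * (T - t) ^ 2)) T := by
      refine h3.congr_deriv ?_
      field_simp
    refine h4.congr_of_eventuallyEq ?_
    filter_upwards [Ioi_mem_nhds hT] with T' hT'
    simp [hG, not_le.2 (mem_Ioi.1 hT')]
  -- behaviour at `t⁺`
  have hsub : Tendsto (fun T : ℝ ↦ T - t) (𝓝[>] t) (𝓝[>] 0) := by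
    refine tendsto_nhdsWithin_of_tendsto_nhds_of_eventually_within _ ?_ ?_
    · have := ((continuous_sub_right t).tendsto t)
      rw [sub_self] at this
      exact this.mono_left nhdsWithin_le_nhds
    · filter_upwards [self_mem_nhdsWithin] with T hT
      exact sub_pos.2 (mem_Ioi.1 hT)
  have hexp0 : Tendsto (fun T : ℝ ↦ Real.exp (-b / (T - t))) (𝓝[>] t) (𝓝 0) := by
    have h1 : Tendsto (fun T : ℝ ↦ (T - t)⁻¹) (𝓝[>] t) atTop := tendsto_inv_nhdsGT_zero.comp hsub
    have h2 : Tendsto (fun T : ℝ ↦ -(b * (T - t)⁻¹)) (𝓝[>] t) atBot :=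
      tendsto_neg_atTop_atBot.comp (h1.const_mul_atTop hb)
    have h3 := Real.tendsto_exp_atBot.comp h2
    refine h3.congr fun T ↦ ?_
    simp [div_eq_mul_inv]
  have hcont : ContinuousWithinAt G (Ici t) t := by
    rw [← continuousWithinAt_Ioi_iff_Ici]
    have hGt : G t = 0 := by simp [hG]
    rw [ContinuousWithinAt, hGt]
    have h := hexp0.div_const (2 * b)
    rw [zero_div] at h
    refine h.congr' ?_
    filter_upwards [self_mem_nhdsWithin] with T hT
    simp [hG, not_le.2 (mem_Ioi.1 hT)]
  -- behaviour at `∞`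
  have hlim : Tendsto G atTop (𝓝 (1 / (2 * b))) := by
    have h1 : Tendsto (fun T : ℝ ↦ (T - t)⁻¹) atTop (𝓝 0) :=
      tendsto_inv_atTop_zero.comp (tendsto_atTop_add_const_right _ _ tendsto_id)
    have h2 : Tendsto (fun T : ℝ ↦ Real.exp (-(b * (T - t)⁻¹)) / (2 * b)) atTop (𝓝 (Real.exp (-(b * 0)) / (2 * b))) :=
      ((Real.continuous_exp.tendsto _).comp ((h1.const_mul b).neg)).div_const _
    simp only [mul_zero, neg_zero, Real.exp_zero] at h2
    refine h2.congr' ?_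
    filter_upwards [eventually_gt_atTop t] with T hT
    simp [hG, not_le.2 hT, div_eq_mul_inv]
  have hnn : ∀ T ∈ Ioi t, 0 ≤ Real.exp (-b / (T - t)) / (2 * (T - t) ^ 2) := fun T _ ↦ by positivity
  refine ⟨integrableOn_Ioi_deriv_of_nonneg hcont hderiv hnn hlim, ?_⟩
  rw [integral_Ioi_of_hasDerivAt_of_nonneg hcont hderiv hnn hlim]
  simp [hG]

/-- The same integral as a lower Lebesgue integral, against the lifetime weight `1/(2T²)`:
for `0 < t < T` one has `(1/(2T²)) · (T/(T−t))² e^{−b/(T−t)} = e^{−b/(T−t)}/(2(T−t)²)`, so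
`∫⁻_{T>t} (1/(2T²)) (T/(T−t))² e^{−b/(T−t)} dT = 1/(2b)`. [folklore] -/
theorem lintegral_Ioi_weight_ratio {b t : ℝ} (hb : 0 < b) (ht : 0 < t) :
    ∫⁻ T in Ioi t, ENNReal.ofReal (1 / (2 * T ^ 2)) *
        ENNReal.ofReal ((T / (T - t)) ^ 2 * Real.exp (-b / (T - t))) = ENNReal.ofReal (1 / (2 * b)) := by
  obtain ⟨hint, hval⟩ := integral_Ioi_exp_neg_div hb t
  rw [← hval, ofReal_integral_eq_lintegral_ofReal hint
    (ae_restrict_of_forall_mem measurableSet_Ioi fun T _ ↦ by positivity)]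
  refine setLIntegral_congr_fun measurableSet_Ioi fun T hT ↦ ?_
  have hT : 0 < T := ht.trans hT
  have hTt : 0 < T - t := sub_pos.2 (mem_Ioi.1 ‹T ∈ Ioi t›)
  rw [← ENNReal.ofReal_mul (by positivity)]
  congr 1
  field_simp

/-! ### Linear combinations of independent Gaussian vectors -/

/-- **`c ξ + e η ~ N(0, (c²a + e²b) I_d)`** for independent `ξ ~ N(0, a I_d)`, `η ~ N(0, b I_d)`:
the image of `N(0, aI) ⊗ N(0, bI)` under `(x, y) ↦ c x + e y`. [folklore] -/
theorem map_linComb_gaussVec_prod (d : ℕ) (a b : ℝ≥0) (c e : ℝ) :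
    ((gaussVec d a).prod (gaussVec d b)).map (fun p : (Fin d → ℝ) × (Fin d → ℝ) ↦ c • p.1 + e • p.2) =
      gaussVec d (⟨c ^ 2, sq_nonneg c⟩ * a + ⟨e ^ 2, sq_nonneg e⟩ * b) := by
  have hmp := measurePreserving_arrowProdEquivProdArrow ℝ ℝ (Fin d) (fun _ ↦ gaussianReal 0 a)
    (fun _ ↦ gaussianReal 0 b)
  have hF : Measurable (fun p : (Fin d → ℝ) × (Fin d → ℝ) ↦ c • p.1 + e • p.2) :=
    (measurable_fst.const_smul c).add (measurable_snd.const_smul e)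
  unfold gaussVec
  rw [← hmp.map_eq, Measure.map_map hF (MeasurableEquiv.measurable _)]
  have hcomp : ((fun p : (Fin d → ℝ) × (Fin d → ℝ) ↦ c • p.1 + e • p.2) ∘
      (MeasurableEquiv.arrowProdEquivProdArrow ℝ ℝ (Fin d))) =
      fun (q : Fin d → ℝ × ℝ) (i : Fin d) ↦ (fun r : ℝ × ℝ ↦ c * r.1 + e * r.2) (q i) := by
    funext q i
    rfl
  rw [hcomp, Measure.pi_map_pi (fun _ ↦ (by fun_prop : Measurable fun r : ℝ × ℝ ↦ c * r.1 + e * r.2).aemeasurable)]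
  congr 1
  funext i
  -- one coordinate: `c X + e Y` for independent Gaussians
  have h1 : (fun r : ℝ × ℝ ↦ c * r.1 + e * r.2) = (fun r : ℝ × ℝ ↦ r.1 + r.2) ∘ Prod.map (fun x ↦ c * x) (fun y ↦ e * y) := by
    funext r; rfl
  rw [h1, ← Measure.map_map (by fun_prop) (by fun_prop),
    ← Measure.map_prod_map _ _ (by fun_prop) (by fun_prop), gaussianReal_map_const_mul,
    gaussianReal_map_const_mul]
  simp only [mul_zero]
  rw [← Measure.conv, gaussianReal_conv_gaussianReal, add_zero]
  rfl

/-! ### Independence: Tonelli for independent random variables -/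

/-- **Freezing an independent variable**: for independent `U`, `ξ` and measurable `F ≥ 0`,
`E[F(U, ξ)] = E_ω[∫ F(U(ω), y) law(ξ)(dy)]`. [folklore] -/
theorem lintegral_comp_eq_lintegral_lintegral_of_indepFun {Ω α β : Type*} [MeasurableSpace Ω]
    [MeasurableSpace α] [MeasurableSpace β] {P : Measure Ω} [IsProbabilityMeasure P] {U : Ω → α}
    {ξ : Ω → β} (hU : Measurable U) (hξ : Measurable ξ) (h : IndepFun U ξ P) {F : α × β → ℝ≥0∞}
    (hF : Measurable F) :
    ∫⁻ ω, F (U ω, ξ ω) ∂P = ∫⁻ ω, ∫⁻ y, F (U ω, y) ∂(P.map ξ) ∂P := by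
  have hprod := (indepFun_iff_map_prod_eq_prod_map_map hU.aemeasurable hξ.aemeasurable).1 h
  haveI : IsProbabilityMeasure (P.map ξ) := Measure.isProbabilityMeasure_map hξ.aemeasurable
  calc ∫⁻ ω, F (U ω, ξ ω) ∂P = ∫⁻ p, F p ∂(P.map fun ω ↦ (U ω, ξ ω)) := by
        rw [lintegral_map hF (hU.prodMk hξ)]
    _ = ∫⁻ p, F p ∂((P.map U).prod (P.map ξ)) := by rw [hprod]
    _ = ∫⁻ x, ∫⁻ y, F (x, y) ∂(P.map ξ) ∂(P.map U) := lintegral_prod _ hF.aemeasurable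
    _ = ∫⁻ ω, ∫⁻ y, F (U ω, y) ∂(P.map ξ) ∂P := by
        rw [lintegral_map hF.lintegral_prod_right' hU]

/-! ### The Brownian bridge part of a path is independent of the endpoint -/

/-- **Bridge part ⟂ endpoint** for a real pre-Brownian motion: the process
`(B_s − (s/t) B_t)_{s ≤ t}` is independent of `B_t` (jointly Gaussian and uncorrelated:
`Cov(B_s − (s/t)B_t, B_t) = s − (s/t)t = 0`). [folklore] -/
theorem _root_.ProbabilityTheory.IsPreBrownianReal.indepFun_bridge {Ω : Type*}
    {mΩ : MeasurableSpace Ω} {P : Measure Ω} {B : ℝ≥0 → Ω → ℝ} (hB : IsPreBrownianReal B P)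
    (t : ℝ≥0) :
    IndepFun (fun ω (s : Set.Iic t) ↦ B s ω - ((s : ℝ≥0) : ℝ) / t * B t ω)
      (fun ω (_u : Unit) ↦ B t ω) P := by
  have mX : ∀ s, AEMeasurable (B s) P := hB.aemeasurable
  haveI := hB.isGaussianProcess.isProbabilityMeasure
  apply IsGaussianProcess.indepFun_of_covariance_eq_zero
  · apply hB.isGaussianProcess.of_isGaussianProcess
    rintro (⟨s, hs⟩ | u)
    · classical
      exact ⟨{s, t},
        { toFun x := x ⟨s, by simp⟩ - ((s : ℝ) / t) * x ⟨t, by simp⟩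
          map_add' x y := by simp; ring
          map_smul' c x := by simp; ring }, by simp⟩
    · exact ⟨{t},
        { toFun x := x ⟨t, by simp⟩
          map_add' x y := by simp
          map_smul' c x := by simp }, by simp⟩
  · intro s
    exact (mX s).sub ((mX t).const_mul _)
  · intro; exact mX t
  · rintro ⟨s, hs : s ≤ t⟩ u
    have h2 : MemLp (B t) 2 P := (hB.isGaussianProcess.hasGaussianLaw_eval _).memLp_two
    have hs2 : MemLp (B s) 2 P := (hB.isGaussianProcess.hasGaussianLaw_eval _).memLp_two
    simp only
    rw [covariance_fun_sub_left hs2 (h2.const_mul _) h2, covariance_const_mul_left,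
      hB.covariance_eval, hB.covariance_eval, min_eq_left hs, min_self]
    rcases eq_or_ne t 0 with rfl | ht
    · have : s = 0 := le_antisymm hs bot_le
      subst this; simp
    · have ht' : ((t : ℝ≥0) : ℝ) ≠ 0 := by exact_mod_cast ht
      field_simp
      ring

/-- The bridge part of one raw Brownian path on `[0, t]`. [folklore] -/
def rawBridgePast (t : ℝ≥0) (ω₁ : ℝ≥0 → ℝ) : Set.Iic t → ℝ :=
  fun s ↦ brownian s ω₁ - ((s : ℝ≥0) : ℝ) / t * brownian t ω₁

/-- The raw bridge part is measurable. [folklore] -/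
theorem measurable_rawBridgePast (t : ℝ≥0) : Measurable (rawBridgePast t) :=
  measurable_pi_lambda _ fun s ↦ (measurable_brownian s).sub ((measurable_brownian t).const_mul _)

/-- **Bridge part ⟂ endpoint for the canonical Brownian motion.** [folklore] -/
theorem indepFun_rawBridgePast (t : ℝ≥0) : IndepFun (rawBridgePast t) (brownian t) preWienerMeasure := by
  have h := (RandomPlanarGeometry.isPreBrownianReal_brownian.indepFun_bridge t).comp measurable_id
    (measurable_pi_apply (Unit.unit))
  exact h

/-- The bridge part of the four-dimensional Brownian path on `[0, t]`:
`s ↦ W_s − (s/t) W_t`. [folklore] -/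
def quadBridgePast (t : ℝ≥0) (ω : WienerQuad) : Set.Iic t → Fin 4 → ℝ :=
  fun s ↦ brownianQuad s ω - (((s : ℝ≥0) : ℝ) / t) • brownianQuad t ω

/-- Assembling four numbers into a vector of `ℝ⁴`. [folklore] -/
def quadPoint (p : (ℝ × ℝ) × (ℝ × ℝ)) : Fin 4 → ℝ := ![p.1.1, p.1.2, p.2.1, p.2.2]

/-- `quadPoint` is measurable. [folklore] -/
theorem measurable_quadPoint : Measurable quadPoint := by
  refine measurable_pi_lambda _ fun i ↦ ?_
  fin_cases i <;> simp [quadPoint] <;> fun_prop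

/-- The bridge part of the vector path is assembled from the four raw bridge parts. [folklore] -/
theorem quadBridgePast_eq (t : ℝ≥0) : quadBridgePast t = quadAssemble ∘
    Prod.map (Prod.map (rawBridgePast t) (rawBridgePast t)) (Prod.map (rawBridgePast t) (rawBridgePast t)) := by
  funext ω s i
  fin_cases i <;> rfl

/-- `W_t` is assembled from the four raw coordinates at time `t`. [folklore] -/
theorem brownianQuad_eq_quadPoint (t : ℝ≥0) : brownianQuad t = quadPoint ∘
    Prod.map (Prod.map (brownian t) (brownian t)) (Prod.map (brownian t) (brownian t)) := by
  funext ω i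
  fin_cases i <;> rfl

/-- The bridge part of the vector path is measurable. [folklore] -/
theorem measurable_quadBridgePast (t : ℝ≥0) : Measurable (quadBridgePast t) :=
  measurable_pi_lambda _ fun s ↦ (measurable_brownianQuad _).sub
    ((measurable_brownianQuad t).const_smul ((((s : ℝ≥0) : ℝ) / t)) :)

/-- **Bridge part ⟂ endpoint for the four-dimensional Brownian motion**: `(W_s − (s/t)W_t)_{s≤t}`
is independent of `W_t`. [folklore] -/
theorem indepFun_quadBridgePast (t : ℝ≥0) : IndepFun (quadBridgePast t) (brownianQuad t) wienerQuad := by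
  haveI := RandomPlanarGeometry.isProbabilityMeasure_preWienerMeasure'
  have h1 := indepFun_rawBridgePast t
  have h2 : IndepFun (Prod.map (rawBridgePast t) (rawBridgePast t)) (Prod.map (brownian t) (brownian t))
      wienerPair :=
    indepFun_prodMap h1 h1 (measurable_rawBridgePast t) (measurable_brownian t)
      (measurable_rawBridgePast t) (measurable_brownian t)
  have h4 := indepFun_prodMap h2 h2 ((measurable_rawBridgePast t).prodMap (measurable_rawBridgePast t))
    ((measurable_brownian t).prodMap (measurable_brownian t))
    ((measurable_rawBridgePast t).prodMap (measurable_rawBridgePast t))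
    ((measurable_brownian t).prodMap (measurable_brownian t))
  rw [quadBridgePast_eq, brownianQuad_eq_quadPoint, wienerQuad]
  exact h4.comp measurable_quadAssemble measurable_quadPoint

/-- **The path on `[0, t]` is its bridge part plus the linear interpolation of the endpoint**:
`W_s = (W_s − (s/t)W_t) + (s/t)W_t`. [folklore] -/
theorem vecPast_eq_quadBridgePast_add (t : ℝ≥0) (ω : WienerQuad) :
    vecPast brownianQuad t ω = quadBridgePast t ω + fun s : Set.Iic t ↦ (((s : ℝ≥0) : ℝ) / t) • brownianQuad t ω := by
  funext s
  simp [vecPast, quadBridgePast]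

end Literature.Probability.Process

end
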